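import Summits.NavierStokesRegularity.FunctionalMining.TopEigHeatConvex
import Summits.NavierStokesRegularity.FunctionalMining.TopEigHeatCoerciveGap
import Mathlib.Tactic.Module
import HarnessLib

/-!
# NO-GO K44a — `N_q = (∫(λ₁⁺)^q)^{1/q}` is a SEMINORM on smooth periodic fields (`q ≥ 1`)
# (door (c), node K6, Lemma L-λ(q); engine file for K44b `NoGo/TopEigHeatTwoShellNorm`)

search for candidate a priori estimates; no regularity claim. Cell `pub-nsfunc`, nogo seat (gen 50),
file K44a. Static convex calculus of the functionals `Φ_q = ∫(λ₁⁺)^q` / `∫((−λ₃)⁺)^q` (`torusTopEigMoment`,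
`torusNegBotEigMoment`) on smooth fields of `𝕋^d`; nothing about Navier–Stokes dynamics, no node decided
(`TopEig.TopEigHeatCoercivePos q` stays OPEN for every real `q > 1`).

WHAT IS PROVED (every real `q ≥ 1`, any nonempty finite index type `d`). With
`N_q(v) := Φ_q(v)^{1/q}` (`topEigNorm`; `negBotEigNorm` for the `−λ₃` core, `N_q(−v) = N⁻_q(v)`):
* `topEigNorm_smul`: `N_q(a • v) = a N_q(v)` for `a ≥ 0` (from the tree's `torusTopEigMoment_smul`);
* `torusTopEigMoment_convexComb_le_one`: the set `{Φ_q ≤ 1}` is convex along segments of smooth fields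
  (from the tree's `convexOn_topEigMoment_line`, i.e. pointwise convexity of `λ₁⁺ ∘ S` + monotone convex `r ↦ r^q`);
* **`topEigNorm_add_le` (Minkowski)**: `N_q(a + b) ≤ N_q(a) + N_q(b)` — `N_q` is the gauge of that convex set;
* **`convexOn_topEigNorm_line`**: `σ ↦ N_q(v + σ w)` is convex — strictly stronger than the convexity of
  `σ ↦ Φ_q(v + σ w) = N_q^q` used in K39/K42/K43, and the input of the sharp two-shell bounds of K44b.
[folklore: the Minkowski functional of a convex absorbing set is sublinear; ours as stated for `Φ_q`]
search for candidate a priori estimates; no regularity claim.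
FILING (prove seat g29, REQUEST #69): declarations byte-identical to the no-go seat's staged `TopEigNormSublinear.STAGING.lean` 291f25a73e4e5683; this line is the only addition.
-/

noncomputable section

open MeasureTheory Set Filter Topology

namespace Summit.NavierStokesRegularity.FunctionalMining

open Literature.Analysis.FunctionSpaces Literature.Analysis.FluidPDE

namespace TopEig

variable {d : Type*} [Fintype d] [DecidableEq d]

/-- `N_q(v) = (∫(λ₁⁺)^q(v))^{1/q}`, the `L^q` norm of `λ₁⁺(S(v))`. [ours; bookkeeping] -/
def topEigNorm (q : ℝ) (v : UnitAddTorus d → EuclideanSpace ℝ d) : ℝ :=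
  torusTopEigMoment q v ^ q⁻¹

/-- `N⁻_q(v) = (∫((−λ₃)⁺)^q(v))^{1/q}`, the `L^q` norm of `(−λ₃)⁺(S(v))`. [ours; bookkeeping] -/
def negBotEigNorm (q : ℝ) (v : UnitAddTorus d → EuclideanSpace ℝ d) : ℝ :=
  torusNegBotEigMoment q v ^ q⁻¹

/-- `N_q ≥ 0`. [bookkeeping] -/
theorem topEigNorm_nonneg (q : ℝ) (v : UnitAddTorus d → EuclideanSpace ℝ d) : 0 ≤ topEigNorm q v :=
  Real.rpow_nonneg (torusTopEigMoment_nonneg q v) _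

/-- `N⁻_q ≥ 0`. [bookkeeping] -/
theorem negBotEigNorm_nonneg (q : ℝ) (v : UnitAddTorus d → EuclideanSpace ℝ d) :
    0 ≤ negBotEigNorm q v :=
  Real.rpow_nonneg (torusNegBotEigMoment_nonneg q v) _

/-- `N_q^q = Φ_q` (`q ≠ 0`). [bookkeeping] -/
theorem topEigNorm_rpow {q : ℝ} (hq : q ≠ 0) (v : UnitAddTorus d → EuclideanSpace ℝ d) :
    topEigNorm q v ^ q = torusTopEigMoment q v :=
  Real.rpow_inv_rpow (torusTopEigMoment_nonneg q v) hq

/-- `(N⁻_q)^q = ∫((−λ₃)⁺)^q` (`q ≠ 0`). [bookkeeping] -/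
theorem negBotEigNorm_rpow {q : ℝ} (hq : q ≠ 0) (v : UnitAddTorus d → EuclideanSpace ℝ d) :
    negBotEigNorm q v ^ q = torusNegBotEigMoment q v :=
  Real.rpow_inv_rpow (torusNegBotEigMoment_nonneg q v) hq

/-- `N_q(−v) = N⁻_q(v)`. [bookkeeping] -/
theorem topEigNorm_neg (q : ℝ) (v : UnitAddTorus d → EuclideanSpace ℝ d) :
    topEigNorm q (-v) = negBotEigNorm q v := by
  simp only [topEigNorm, negBotEigNorm, torusTopEigMoment_neg]

/-- Positive homogeneity: `N_q(a • v) = a N_q(v)` for `a ≥ 0`. [ours; bookkeeping] -/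
theorem topEigNorm_smul [Nonempty d] {q : ℝ} (hq : q ≠ 0) {a : ℝ} (ha : 0 ≤ a)
    {v : UnitAddTorus d → EuclideanSpace ℝ d} (hv : Torus.IsSmooth v) :
    topEigNorm q (a • v) = a * topEigNorm q v := by
  unfold topEigNorm
  rw [torusTopEigMoment_smul q ha hv, Real.mul_rpow (Real.rpow_nonneg ha q) (torusTopEigMoment_nonneg q v),
    Real.rpow_rpow_inv ha hq]

/-- The unit ball of `N_q` is convex: `Φ_q(α • a + β • b) ≤ 1` if `Φ_q(a), Φ_q(b) ≤ 1`, `α, β ≥ 0`,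
`α + β = 1` (convexity of `Φ_q` along the segment). [folklore; ours as stated] -/
theorem torusTopEigMoment_convexComb_le_one [Nonempty d] {q : ℝ} (hq : 1 ≤ q)
    {a b : UnitAddTorus d → EuclideanSpace ℝ d} (ha : Torus.IsSmooth a) (hb : Torus.IsSmooth b)
    (h1a : torusTopEigMoment q a ≤ 1) (h1b : torusTopEigMoment q b ≤ 1) {α β : ℝ} (hα : 0 ≤ α)
    (hβ : 0 ≤ β) (hαβ : α + β = 1) : torusTopEigMoment q (α • a + β • b) ≤ 1 := by
  have hconv := convexOn_topEigMoment_line hq ha (hb.add ha.neg) (w := b + -a)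
  have h := hconv.2 (mem_univ (0 : ℝ)) (mem_univ (1 : ℝ)) hα hβ hαβ
  simp only [smul_eq_mul, mul_zero, mul_one, zero_add, zero_smul, add_zero, one_smul] at h
  have hα' : α = 1 - β := by linarith
  have e : a + β • (b + -a) = α • a + β • b := by rw [hα']; module
  have e2 : a + (b + -a) = b := by abel
  rw [e, e2] at h
  nlinarith

/-- **Minkowski for `N_q`** (`q ≥ 1`): `N_q(a + b) ≤ N_q(a) + N_q(b)` on smooth fields — `N_q` is the gauge
of the convex set `{Φ_q ≤ 1}`. [folklore (gauge of a convex absorbing set); ours as stated] -/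
theorem topEigNorm_add_le [Nonempty d] {q : ℝ} (hq : 1 ≤ q)
    {a b : UnitAddTorus d → EuclideanSpace ℝ d} (ha : Torus.IsSmooth a) (hb : Torus.IsSmooth b) :
    topEigNorm q (a + b) ≤ topEigNorm q a + topEigNorm q b := by
  have hq0 : 0 < q := by linarith
  refine le_of_forall_pos_le_add fun ε hε => ?_
  obtain ⟨s, hs_def⟩ : ∃ s : ℝ, s = topEigNorm q a + ε / 2 := ⟨_, rfl⟩
  obtain ⟨t, ht_def⟩ : ∃ t : ℝ, t = topEigNorm q b + ε / 2 := ⟨_, rfl⟩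
  have hs : 0 < s := by rw [hs_def]; linarith [topEigNorm_nonneg q a]
  have ht : 0 < t := by rw [ht_def]; linarith [topEigNorm_nonneg q b]
  have hst : 0 < s + t := add_pos hs ht
  -- normalised fields lie in the unit ball of `Φ_q`
  have key : ∀ {c : ℝ} {x : UnitAddTorus d → EuclideanSpace ℝ d}, Torus.IsSmooth x → 0 < c →
      topEigNorm q x < c → torusTopEigMoment q (c⁻¹ • x) ≤ 1 := by
    intro c x hx hc hlt
    rw [torusTopEigMoment_smul q (inv_nonneg.mpr hc.le) hx, ← topEigNorm_rpow hq0.ne' x,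
      ← Real.mul_rpow (inv_nonneg.mpr hc.le) (topEigNorm_nonneg q x)]
    refine Real.rpow_le_one (mul_nonneg (inv_nonneg.mpr hc.le) (topEigNorm_nonneg q x)) ?_ hq0.le
    rw [inv_mul_le_iff₀ hc, mul_one]
    exact hlt.le
  have h1a := key ha hs (by rw [hs_def]; linarith)
  have h1b := key hb ht (by rw [ht_def]; linarith)
  have hα : 0 ≤ s / (s + t) := by positivity
  have hβ : 0 ≤ t / (s + t) := by positivity
  have hαβ : s / (s + t) + t / (s + t) = 1 := by field_simp
  have hcomb := torusTopEigMoment_convexComb_le_one hq (Torus.IsSmooth.smul _ ha) (Torus.IsSmooth.smul _ hb)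
    h1a h1b hα hβ hαβ
  -- undo the normalisation
  have e1 : (s + t) * (s / (s + t)) * s⁻¹ = 1 := by field_simp
  have e2 : (s + t) * (t / (s + t)) * t⁻¹ = 1 := by field_simp
  have hab : a + b = (s + t) • ((s / (s + t)) • (s⁻¹ • a) + (t / (s + t)) • (t⁻¹ • b)) := by
    rw [smul_add, smul_smul, smul_smul, smul_smul, smul_smul, e1, e2, one_smul, one_smul]
  have hsm : Torus.IsSmooth ((s / (s + t)) • (s⁻¹ • a) + (t / (s + t)) • (t⁻¹ • b)) :=
    (Torus.IsSmooth.smul _ (Torus.IsSmooth.smul _ ha)).add (Torus.IsSmooth.smul _ (Torus.IsSmooth.smul _ hb))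
  have hΦ : torusTopEigMoment q (a + b) ≤ (s + t) ^ q := by
    rw [hab, torusTopEigMoment_smul q hst.le hsm]
    have := Real.rpow_nonneg hst.le q
    nlinarith
  calc topEigNorm q (a + b) = torusTopEigMoment q (a + b) ^ q⁻¹ := rfl
    _ ≤ ((s + t) ^ q) ^ q⁻¹ :=
        Real.rpow_le_rpow (torusTopEigMoment_nonneg q _) hΦ (inv_nonneg.mpr hq0.le)
    _ = s + t := Real.rpow_rpow_inv hst.le hq0.ne'
    _ = topEigNorm q a + topEigNorm q b + ε := by rw [hs_def, ht_def]; ring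

/-- **`σ ↦ N_q(v + σ w)` is convex** for smooth `v, w` and `q ≥ 1`. [ours] -/
theorem convexOn_topEigNorm_line [Nonempty d] {q : ℝ} (hq : 1 ≤ q)
    {v w : UnitAddTorus d → EuclideanSpace ℝ d} (hv : Torus.IsSmooth v) (hw : Torus.IsSmooth w) :
    ConvexOn ℝ univ (fun σ : ℝ => topEigNorm q (v + σ • w)) := by
  have hq0 : q ≠ 0 := by positivity
  refine ⟨convex_univ, fun x _ y _ α β hα hβ hαβ => ?_⟩
  have hx : Torus.IsSmooth (v + x • w) := hv.add (Torus.IsSmooth.smul _ hw)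
  have hy : Torus.IsSmooth (v + y • w) := hv.add (Torus.IsSmooth.smul _ hw)
  have hβ' : β = 1 - α := by linarith
  have e : v + (α • x + β • y) • w = α • (v + x • w) + β • (v + y • w) := by
    rw [smul_eq_mul, smul_eq_mul, hβ']; module
  show topEigNorm q (v + (α • x + β • y) • w) ≤ α • topEigNorm q (v + x • w) + β • topEigNorm q (v + y • w)
  rw [e, smul_eq_mul, smul_eq_mul, ← topEigNorm_smul hq0 hα hx, ← topEigNorm_smul hq0 hβ hy]
  exact topEigNorm_add_le hq (Torus.IsSmooth.smul _ hx) (Torus.IsSmooth.smul _ hy)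

end TopEig

end Summit.NavierStokesRegularity.FunctionalMining

-- search for candidate a priori estimates; no regularity claim
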